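import Literature.MathematicalPhysics.QuantumFieldTheory.Balaban1983to89.B13DirichletLocalCLettersLocated
import Literature.MathematicalPhysics.QuantumFieldTheory.Balaban1983to89.B13DirichletLocalRProjLetters
import Literature.MathematicalPhysics.QuantumFieldTheory.Balaban1983to89.B13DirichletLocalDeltaALetters
import Literature.MathematicalPhysics.QuantumFieldTheory.Balaban1983to89.B13GreenSymLettersOfReg335Located

/-!
# `Balaban1983to89.B13DirichletLocalRoadPadLettersLocated` — T. Bałaban, *Propagators for lattice gauge theories in a background field*, Commun. Math. Phys. **99**
# (1985) 389–434 [Balaban1985BackgroundPropagators], (3.25)–(3.26) pp. 394–395 («Δ_a(U) = Δ(U) + D_U R(U) D\*_U + Q\*(U)aQ(U)»), (3.35) p. 396, Thm 3.1 (3.42) p. 397,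
# Thm 3.4 p. 400, Sect. C pp. 408–409 («G′_□(U), C_□(U) = (Q′(U)G′_□²(U)Q′\*(U))⁻¹ … satisfy all the inequalities of Theorems 3.1–3.3», «G_□(U)»), (3.87) p. 409,
# (3.105) p. 414, Thm 3.10 (3.107)–(3.108) p. 416, Thm 3.11 p. 416 («G_□(e^{iηA}) = G_□(1)(I − V(A)G_□(1))⁻¹»); [Balaban1988RG2Cluster] (2.5)–(2.7) pp. 12–13, p. 15;
# [Balaban1984PropagatorsII] (2.54) p. 232, Lemma 2.1 (2.61) p. 234, (2.69) p. 235: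
# ★★★ THE END-TO-END INSTANCE OF THE N10 LANE's LOCAL-CUBE ROAD — the N10 entry letters of def-Y's DIRICHLET-COMPRESSED LOCALISED OPERATOR
# `A′ ↦ padDeltaALocY i parSymY parBY D (M_{χ_P}) (M_χ) (e^{iηA′}U₀)` ALONG pv27's PENCIL, for EVERY background `U₀` of the class (3.35) and at `U₀ = 1`,
# with NO displayed operator-side hypothesis: stations L1 (dag-n10-w3) → L2 (dag-n10-w5) → L3 (dag-n10-w6) → the local part (dag-n10-w4) → L4 (dag-n10-w3)
# composed BY NAME, every dictionary numeral a number.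

[folklore] bookkeeping: ONE composition of cited tree theorems BY NAME; THEOREMS ONLY (no `def`, no `structure`, no instance, no notation); nothing of NODE 00's ∕
N06's ∕ the N10 stations' files is modified or restated; nothing here is a claim about the Yang–Mills mass gap; no node is discharged; count-neutral.

THE ROAD (N10 lane census v21.1 item 5; dag-n10-w3 g5's design, fan-out L1 w3 · L2 w5 · L3 w6 · L4∕L5 w3; dag-n10-w3 g5 HANDOFF «NEXT (3): END-TO-END `U₀ = 1`
instance of the local road … L1 §4 → L2 → L3 §4 → L4 §2–§3 → L5 §2»).  Row 17 of node N06's certificate ([B9] Thm 3.11) is reduced by dag-n06-j's local road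
(`Summits/…/BalabanUVNodesN06Row17LocalClauseOnReg335OfL5Letters` ∘ `…LocalCentreEveryCubeOfKIdx`) to station L5 (`B13DirichletLocalCoerciveBall`), whose
letters input `hA : RawEntryLetters (A′ ↦ toMatrix (padDeltaALocY … (e^{iηA′}·1))) loc R ρ B` was DISPLAYED.  THIS FILE produces it:
* L1 §5 `B13DirichletLocalInverseLetters.rawEntryLetters_toMatrix_GsqY_parSymY_prodCfg_of_reg335_fineReading` — `G′_□`'s pencil letters at the fine reading
  (module 78 + dag-n06-w1's Theorem-3.1 site coercivity on (3.35); radius `R₁`, rate `κ₁`);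
* L2 `B13DirichletLocalCLettersLocated.rawEntryLetters_toMatrix_ClocY_parSymY_prodCfg_of_reg335_located` — `C_□`'s pencil letters at the block reading
  (regime-free centre `(4(d+1)+1)⁻²`; radius `R′`, rate `κ`; NO N06 binder);
* L3 §4 `B13DirichletLocalRProjLetters.rawEntryLetters_toMatrix_RlocY_parSymY_prodCfg` — `R_□ = I − G′_□Q′*C_□Q′G′_□` on the site sector (rate `κ − 2μ′`),
  fed by L1's letters restricted to `(R′, κ)` (`rawEntryLetters_mono`) and L2's, with the numerals `K₀ = 1` (`B13GreenPrimeSymLettersOfReg335.norm_unit_le_one_of_mem`),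
  `D_Q = (d+1)(L^k − 1)` (`B13BlockBondReadingNumerals.tdist_chart_blkCornerY_le_of_blkOf_eq`), `CQsr = CQc = 1` (`B13GreenSymLettersOfReg335Located.sum_abs_qpsK_le_one ∕
  sum_abs_qpK_col_le_one`), readings `fineReadingY ∕ blkReadingY i i.hN` with `r = (d+1)(L^k − 1)` (`hℓQ_blkReadingY ∕ hℓQs_blkReadingY`), fibre `N²`
  (`B13SiteReadingNumerals.hfib_fineReadingY_matrixUnits`), basis numerals `cb = cl = 1` (`B13MatrixUnitBasisNumerals`);
* the local part `Δ(U) + Q*(U)aQ(U)` along the pencil at the bond reading: dag-n10-w4's `B13DeltaAPencilLettersLocated.rawEntryLetters_toMatrix_localDeltaA_prodCfg_located`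
  (rate `κ − 2μ′`, radius `R′`);
* L4 §2 `B13DirichletLocalDeltaALetters.rawEntryLetters_toMatrix_deltaALocY_prodCfg` (`D_U·R_□·D*_U` sandwich, numerals `C_∂ = C_∂* = 2|c_f|` from
  `B13GreenStationLocated.sum_abs_gradK_le ∕ sum_abs_divK_le`, `r′ = 1` from `hℓG_bondReadingY ∕ hℓD_bondReadingY`) and §3 `…padDeltaALocY_prodCfg` (the 0∕1 bond cut).

WHAT THIS FILE PROVES (all `theorem`s; `i : KIdx` def-Y's index, `L = ℓ + 1`, dimension `d + 1`, `N ≥ 1`, `G ≤ U(N)`; matrix-unit coordinates; readings of record).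
* §1 ★★★ `rawEntryLetters_toMatrix_padDeltaALocY_parSymY_prodCfg_of_reg335_located` — for EVERY `U₀ ∈ (bg9K … G i).Reg335 c α₀` with `c·M·α₀·(d+1) ≤ 1∕16`, every
  site set `D`, block set `Dblk` inside `D` (`hDD`), 0∕1 bond cut `χ`, `η`, chart radius `Rc > 0`, rate `ρ > 0` and the stations' NUMERIC windows (L1's thin radius
  `0 < R₁ ≤ Rc` and Combes–Thomas rate `κ₁` with their two inequalities; the X∕C-station's rate loss `0 < μ < κ₁`, radius `0 ≤ R′ ≤ R₁` and rate `κ` with their two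
  inequalities; L3's rate loss `0 < μ′`, `2μ′ < κ` — inequalities between NUMBERS, the two station constants `B` (78's) and `B_X` bound once by equation binders,
  `rfl` at the call site): `RawEntryLetters (A′ ↦ toMatrix (padDeltaALocY i (parSymY i) (parBY i) D (cutMulY (blkIndY i Dblk)) (cutMulY χ) (prodCfg U₀ η A′)))
  (bondReadingY i i.hN ∘ fst) R′ (κ − 2μ′) (B_pad)` with `B_pad` EXPLICIT (L4's constant over L3's over L2's∕L1's, verbatim).
* §2 ★★★ `rawEntryLetters_toMatrix_padDeltaALocY_parSymY_prodCfg_one_located` — the `U₀ = 1` instance: the class hypothesis is `B9BackgroundsKLevelV1.reg335_one`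
  at `c = (16·M·(d+1))⁻¹`, `α₀ = 1` (so `c·M·α₀·(d+1) = 1∕16`); displayed ONLY `G ≤ U(N)`, `hDD`, `hχ`, `η`, `Rc`, `ρ` and the numeric windows — row 17's `hA`.

HONEST FRAMING: a composition; chart ball around `U₀` of LOCATED radius — the located road's chart radius is k-DEPENDENT (dag-n10-w3 g5's LOCATED (c): `∝ L^{−2k}·Rc` at
L1, thinner at L2∕L3); the k-uniform edition is the (3.37)-scaled pencil (N10's W-stations W1–W3), not this file; finite-lattice constants (`Θ = √((L^k)^{d+1})`,
`D_Q`, `c_a = |b₁|c_f²(L^k)^{d+1}`), not print's `O(1)`; print's multi-scale rate (3.48) NOT claimed; which readings ∕ `η` are «of record» is NODE 00's ∕ def-T's word;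
nothing of Bałaban's Thm 3.2 ∕ 3.4 ∕ 3.10 asserted beyond the cited tree theorems; N06 ∕ N10 NOT discharged; K1⁹ NOT closed, no registered stub proved; counts
unmoved; 0 `def`, 0 `sorry`, standard axioms; one finite 𝕋⁴ programme at fixed ε, Bałaban AS PRINTED — R4 closes the conditional finite-𝕋⁴ rung `BalabanLadder.UV`
only; the YM mass gap (Clay) is NOT proved by any of this; nothing continuum ∕ ℝ⁴ ∕ OS.  Filed `--kind proof --supports` K1⁹ (stmt-QuantumFields-27364), Literature
lane; seat `pub-ymgap-dag-n06-j` g28 (the CONSUMER of row 17's `hA` slot; N10 lane word «NOT MINE — GO», bus 2026-08-28T23:34Z).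

References: T. Bałaban, CMP 99 (1985) 389–434 [Balaban1985BackgroundPropagators] (3.3) p.391, (3.8) p.392, (3.19)–(3.21) pp.393–394, (3.25)–(3.26) pp.394–395,
(3.35) p.396, Thm 3.1 (3.42) p.397, Thm 3.2 (3.48) p.398, Thm 3.4 p.400, (3.66)–(3.72) pp.403–405, (3.87) p.409, Sect. C pp.408–409, (3.105) p.414, Thm 3.10
(3.107)–(3.108) p.416, Thm 3.11 p.416; CMP 116 (1988) 1–22 [Balaban1988RG2Cluster] (2.5)–(2.7) pp.12–13, p.15; CMP 96 (1984) 223–250 [Balaban1984PropagatorsII]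
(2.54) p.232, Lemma 2.1 (2.61) p.234, (2.69) p.235.
-/

noncomputable section

namespace Literature.MathematicalPhysics.QuantumFieldTheory.Balaban1983to89.B13DirichletLocalRoadPadLettersLocated

open Metric Set Finset Module
open scoped Matrix Matrix.Norms.L2Operator
open Literature.MathematicalPhysics.QuantumFieldTheory.Balaban1983to89
open Literature.MathematicalPhysics.QuantumFieldTheory.Balaban1983to89.B9Thm37GlueTorus (tdist1)
open Literature.MathematicalPhysics.QuantumFieldTheory.Balaban1983to89.B5TorusCover (UT)
open Literature.MathematicalPhysics.QuantumFieldTheory.Balaban1983to89.B13EntrywiseWalks (RawEntryLetters)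
open Literature.MathematicalPhysics.QuantumFieldTheory.Balaban1983to89.B13EntryLetterAlgebra (rawEntryLetters_mono)
open Literature.MathematicalPhysics.QuantumFieldTheory.Balaban1983to89.B9Thm37CubeCoverCommutators (cutMulY)
open Literature.MathematicalPhysics.QuantumFieldTheory.Balaban1983to89.B9Thm39CubeOpsAtLettersY (blkIndY)
open Literature.MathematicalPhysics.QuantumFieldTheory.Balaban1983to89.B13SiteReadingNumerals (fineReadingY hfib_fineReadingY_matrixUnits)
open Literature.MathematicalPhysics.QuantumFieldTheory.Balaban1983to89.B13BlockBondReadingNumerals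
  (blkReadingY bondReadingY hℓQ_blkReadingY hℓQs_blkReadingY hℓG_bondReadingY hℓD_bondReadingY tdist_chart_blkCornerY_le_of_blkOf_eq)
open Literature.MathematicalPhysics.QuantumFieldTheory.Balaban1983to89.B9Eq3104CutoffCommutatorSizes (qpK_ne_zero_imp qpsK_ne_zero_imp)
open Literature.MathematicalPhysics.QuantumFieldTheory.Balaban1983to89.B13MatrixUnitBasisNumerals (norm_stdBasis_repr_le norm_stdBasis_le_one)
open Literature.MathematicalPhysics.QuantumFieldTheory.Balaban1983to89.B13GreenPrimeSymLettersOfReg335 (norm_unit_le_one_of_mem)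
open Literature.MathematicalPhysics.QuantumFieldTheory.Balaban1983to89.B13GreenStationLocated (sum_abs_gradK_le sum_abs_divK_le)
open Literature.MathematicalPhysics.QuantumFieldTheory.Balaban1983to89.B13GreenSymLettersOfReg335Located (sum_abs_qpsK_le_one sum_abs_qpK_col_le_one)
open Literature.MathematicalPhysics.QuantumFieldTheory.Balaban1983to89.B13DirichletLocalInverseLetters
  (rawEntryLetters_toMatrix_GsqY_parSymY_prodCfg_of_reg335_fineReading)
open Literature.MathematicalPhysics.QuantumFieldTheory.Balaban1983to89.B13DirichletLocalCLettersLocated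
  (rawEntryLetters_toMatrix_ClocY_parSymY_prodCfg_of_reg335_located)
open Literature.MathematicalPhysics.QuantumFieldTheory.Balaban1983to89.B13DirichletLocalRProjLetters (rawEntryLetters_toMatrix_RlocY_parSymY_prodCfg)
open Literature.MathematicalPhysics.QuantumFieldTheory.Balaban1983to89.B13DeltaAPencilLettersLocated (rawEntryLetters_toMatrix_localDeltaA_prodCfg_located)
open Literature.MathematicalPhysics.QuantumFieldTheory.Balaban1983to89.B13DirichletLocalDeltaALetters
  (rawEntryLetters_toMatrix_deltaALocY_prodCfg rawEntryLetters_toMatrix_padDeltaALocY_prodCfg)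
open Literature.MathematicalPhysics.QuantumFieldTheory.Balaban1983to89.B9Eq39Adjoint (prodCfg)
open Literature.MathematicalPhysics.QuantumFieldTheory.Balaban1983to89.B6GlobalChartV1 (PV boxEquiv)
open Literature.MathematicalPhysics.QuantumFieldTheory.Balaban1983to89.B6KLevelCensusIndexV1 (KIdx kGeo)
open Literature.MathematicalPhysics.QuantumFieldTheory.Balaban1983to89.B9BackgroundsKLevelV1 (bg9K reg335_one eta_pos_L_one_le_M_pos)
open Literature.MathematicalPhysics.QuantumFieldTheory.Balaban1983to89.B6Geom246MultiLevelBox (blkOf)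
open Literature.MathematicalPhysics.QuantumFieldTheory.Balaban1983to89.Node00.OpsYDeltaALocal (padDeltaALocY)
open Literature.MathematicalPhysics.QuantumFieldTheory.Balaban1983to89.Node00

variable {d ℓ : ℕ} {hd : 1 ≤ d + 1} {hL : Odd (ℓ + 1) ∧ 1 < ℓ + 1} {b₀ b₁ : ℝ}
variable (i : KIdx d ℓ hd hL b₀ b₁) {N : ℕ} [NeZero N] {G : Subgroup (Matrix (Fin N) (Fin N) ℂ)ˣ}

/-! ## §1. ★★★ The compressed localised operator along the pencil around EVERY background of the class (3.35) -/

/-- ★★★ **THE END-TO-END LOCAL-CUBE ROAD: `A′ ↦ padDeltaALocY (e^{iηA′}U₀)` IN N10 COORDINATES AROUND EVERY `U₀` OF THE CLASS (3.35).**  For `G ≤ U(N)`,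
`U₀ ∈ (bg9K … G i).Reg335 c α₀` with `c·M·α₀·(d+1) ≤ 1∕16`, a site set `D = □̃`, a block set `Dblk` whose blocks lie inside `D` (`hDD`; the block cut `P = M_{χ_P}`,
`χ_P = blkIndY i Dblk`), a 0∕1 bond cut `χ`, a pencil parameter `η`, a chart radius `Rc > 0`, a rate `ρ > 0`, and the stations' numeric windows (L1's thin radius `R₁` and
Combes–Thomas rate `κ₁`; the X∕C-station's rate loss `μ`, radius `R′`, rate `κ`; L3's rate loss `μ′` with `2μ′ < κ`; the letter constants `B` (module 78's at the fine
reading) and `B_X` (the X-station's) bound ONCE by equation binders):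
`RawEntryLetters (A′ ↦ toMatrix (padDeltaALocY i (parSymY i) (parBY i) D (cutMulY (blkIndY i Dblk)) (cutMulY χ) (prodCfg U₀ η A′))) (bondReadingY i i.hN ∘ fst) R′ (κ − 2μ′) B_pad`
with `B_pad = B_L + (2|c_f|·N²·e^{2|η|R′})²·B_R·e^{2(κ−2μ′)} + 1` — L1 §5 → L2 (located) → L3 §4 → the located local part → L4 §2 → L4 §3, every numeral a number
(`K₀ = 1`, `D_Q = r = (d+1)(L^k − 1)`, `CQsr = CQc = 1`, `C_∂ = C_∂* = 2|c_f|`, `r′ = 1`, `cb = cl = 1`, fibres `N²`).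
[cite: Balaban1985BackgroundPropagators, (3.25)–(3.26) pp.394–395, (3.35) p.396, Thm 3.1 (3.42) p.397, Thm 3.4 p.400, Sect. C pp.408–409 (G′_□, C_□, G_□), (3.87) p.409,
(3.105) p.414, Thm 3.10 (3.107)–(3.108) p.416, Thm 3.11 p.416; Balaban1988RG2Cluster, (2.5)–(2.7) pp.12–13, p.15; Balaban1984PropagatorsII, (2.54) p.232, Lemma 2.1 (2.61) p.234, (2.69) p.235] -/
theorem rawEntryLetters_toMatrix_padDeltaALocY_parSymY_prodCfg_of_reg335_located
    (hG : G ≤ B7Prop2Explicit.unitaryUnits (Matrix (Fin N) (Fin N) ℂ))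
    {U₀ : CfgY (Matrix (Fin N) (Fin N) ℂ) i} {c α₀ : ℝ} (hC0 : 0 ≤ c * (kGeo i).M * α₀) (hC1 : c * (kGeo i).M * α₀ * ((d : ℝ) + 1) ≤ 1 / 16)
    (hreg : (bg9K (Matrix (Fin N) (Fin N) ℂ) G i).Reg335 c α₀ U₀) (D : Finset (SiteY i)) {Dblk : Finset (BlkY i)}
    (hDD : ∀ z : SiteY i, blkOf i.D.toDomains z ∈ Dblk → z ∈ D)
    {χ : FBondY i → ℝ} (hχ : ∀ bb, χ bb = 0 ∨ χ bb = 1)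
    (η : ℝ) {Rc : ℝ} (hRc : 0 < Rc) {ρ : ℝ} (hρ : 0 < ρ)
    -- module 78's letters constant at the fine-reading numerals (L1 §5's binder), bound once (`rfl` at the call site)
    {B : ℝ} (hB : B = (1 * (((d : ℝ) + 1) *
          (1 * Real.exp (|η| * Rc) * (1 * Real.exp (|η| * Rc) * 1 * (1 * Real.exp (|η| * Rc)) + 1) * (1 * Real.exp (|η| * Rc)) +
            (1 * Real.exp (|η| * Rc) * 1 * (1 * Real.exp (|η| * Rc)) + 1)) +
          1 * ((1 * Real.exp (|η| * Rc)) ^ (2 * (d + 1) * ((ℓ + 1) ^ i.k - 1)) * 1 * (1 * Real.exp (|η| * Rc)) ^ (2 * (d + 1) * ((ℓ + 1) ^ i.k - 1)))) *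
          Real.exp (ρ * (((d : ℝ) + 1) * ((((ℓ + 1) ^ i.k : ℕ) : ℝ))))))
    -- L1's thin radius and Combes–Thomas window
    {R₁ : ℝ} (hR₁ : 0 < R₁) (hR₁R : R₁ ≤ Rc)
    (hmarg₁ : 0 < min ((1 / 8 : ℝ) * (((((ℓ + 1) ^ i.k : ℕ) : ℝ)) ^ 2)⁻¹) 1 - 2 * ((B + 1) * ((N * N : ℕ) * B6.c0 1 ρ ^ (d + 1))) * R₁ / Rc)
    {κ₁ : ℝ} (hκ₁ : 0 < κ₁) (hκ₁4 : κ₁ ≤ ρ / 4)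
    (hκ₁m : 8 * (B + 1) * κ₁ * ((N * N : ℕ) * B6.c0 1 (ρ / 2) ^ (d + 1)) ≤
      (min ((1 / 8 : ℝ) * (((((ℓ + 1) ^ i.k : ℕ) : ℝ)) ^ 2)⁻¹) 1 - 2 * ((B + 1) * ((N * N : ℕ) * B6.c0 1 ρ ^ (d + 1))) * R₁ / Rc) * ρ)
    -- the X-station's rate loss and constant (bound once, `rfl` at the call site)
    {μ : ℝ} (hμ : 0 < μ) (hμκ : μ < κ₁)
    {BX : ℝ} (hBX : BX = 1 * (Fintype.card (Fin N × Fin N) : ℝ) *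
          (1 * ((1 * Real.exp (|η| * Rc)) ^ ((d + 1) * ((ℓ + 1) ^ i.k - 1)) * 1 * (1 * Real.exp (|η| * Rc)) ^ ((d + 1) * ((ℓ + 1) ^ i.k - 1)))) *
        ((((ℓ : ℝ) + 1) ^ i.k) ^ (d + 1) * (Fintype.card (Fin N × Fin N) : ℝ) *
          (1 * ((1 * Real.exp (|η| * Rc)) ^ ((d + 1) * ((ℓ + 1) ^ i.k - 1)) * 1 * (1 * Real.exp (|η| * Rc)) ^ ((d + 1) * ((ℓ + 1) ^ i.k - 1))))) *
        (4 / (min ((1 / 8 : ℝ) * (((((ℓ + 1) ^ i.k : ℕ) : ℝ)) ^ 2)⁻¹) 1 - 2 * ((B + 1) * ((N * N : ℕ) * B6.c0 1 ρ ^ (d + 1))) * R₁ / Rc) *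
          (4 / (min ((1 / 8 : ℝ) * (((((ℓ + 1) ^ i.k : ℕ) : ℝ)) ^ 2)⁻¹) 1 - 2 * ((B + 1) * ((N * N : ℕ) * B6.c0 1 ρ ^ (d + 1))) * R₁ / Rc)) *
          (((N * N : ℕ) : ℝ) * B6.c0 1 μ ^ (d + 1))) *
        Real.exp (2 * (κ₁ - μ) * (((d : ℝ) + 1) * (((((ℓ + 1) ^ i.k : ℕ) : ℝ)) - 1))))
    -- the C-station's radius and window at `m = (4(d+1)+1)⁻²`
    {R' : ℝ} (hR' : 0 ≤ R') (hR'R : R' ≤ R₁)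
    (hmarg : 0 < ((4 * ((d : ℝ) + 1) + 1) ^ 2)⁻¹ -
      2 * ((Real.sqrt ((((ℓ : ℝ) + 1) ^ i.k) ^ (d + 1)) * 1 * (BX + 1)) * (((N * N : ℕ) : ℝ) * B6.c0 1 (κ₁ - μ) ^ (d + 1))) * R' / R₁)
    {κ : ℝ} (hκ : 0 ≤ κ) (hκ4 : κ ≤ (κ₁ - μ) / 4)
    (hκm : 8 * (Real.sqrt ((((ℓ : ℝ) + 1) ^ i.k) ^ (d + 1)) * 1 * (BX + 1)) * κ * (((N * N : ℕ) : ℝ) * B6.c0 1 ((κ₁ - μ) / 2) ^ (d + 1)) ≤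
      (((4 * ((d : ℝ) + 1) + 1) ^ 2)⁻¹ -
        2 * ((Real.sqrt ((((ℓ : ℝ) + 1) ^ i.k) ^ (d + 1)) * 1 * (BX + 1)) * (((N * N : ℕ) : ℝ) * B6.c0 1 (κ₁ - μ) ^ (d + 1))) * R' / R₁) * (κ₁ - μ))
    -- L3's rate loss
    {μ' : ℝ} (hμ' : 0 < μ') (h2μ' : 2 * μ' < κ) :
    RawEntryLetters (fun a : Fin (d + 1) → Site (PV d ℓ i.m i.K hd hL) 0 → Matrix (Fin N) (Fin N) ℂ =>
        LinearMap.toMatrix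
          ((Pi.basis fun _ : FBondY i => Matrix.stdBasis ℂ (Fin N) (Fin N)).reindex (Equiv.sigmaEquivProd (FBondY i) (Fin N × Fin N)))
          ((Pi.basis fun _ : FBondY i => Matrix.stdBasis ℂ (Fin N) (Fin N)).reindex (Equiv.sigmaEquivProd (FBondY i) (Fin N × Fin N)))
          (padDeltaALocY i (parSymY i) (parBY i) D (cutMulY (blkIndY i Dblk)) (cutMulY χ) (prodCfg U₀ η a)))
      (fun p : FBondY i × (Fin N × Fin N) => bondReadingY i i.hN p.1) R' (κ - 2 * μ')
      -- `B_pad = B_L + a_D·b_D·B_R·e^{2(κ−2μ′)r′} + 1`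
      (1 * (((4 * ((d : ℝ) + 1) * |i.cf|) * (1 * Real.exp (|η| * R') *
              ((1 * Real.exp (|η| * R')) ^ 4 * ((4 * |i.cf|) * (1 * Real.exp (|η| * R') * 1 * (1 * Real.exp (|η| * R'))))) *
              (1 * Real.exp (|η| * R'))) +
            1 / 2 * ((4 * ((d : ℝ) + 1)) * (1 * Real.exp (|η| * R') *
              (2 * (i.cf ^ 2 * (1 * Real.exp (|η| * R')) ^ 4) * (8 * (1 * Real.exp (|η| * R') * 1 * (1 * Real.exp (|η| * R'))))) *
              (1 * Real.exp (|η| * R'))))) +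
          2 * ((1 * Real.exp (|η| * R')) ^ ((d + 2) * ((ℓ + 1) ^ i.k - 1)) *
            ((|b₁| * i.cf ^ 2 * ((((ℓ + 1 : ℕ) : ℝ)) ^ i.k) ^ (d + 1)) *
              (1 * ((1 * Real.exp (|η| * R')) ^ ((d + 2) * ((ℓ + 1) ^ i.k - 1)) * 1 * (1 * Real.exp (|η| * R')) ^ ((d + 2) * ((ℓ + 1) ^ i.k - 1))))) *
            (1 * Real.exp (|η| * R')) ^ ((d + 2) * ((ℓ + 1) ^ i.k - 1)))) *
          Real.exp ((κ - 2 * μ') * (2 * (((d : ℝ) + 2) * ((((ℓ + 1) ^ i.k : ℕ) : ℝ) - 1)))) +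
        2 * |i.cf| * (Fintype.card (Fin N × Fin N) : ℝ) * (1 * (1 * Real.exp (|η| * R') * 1 * (1 * Real.exp (|η| * R')))) *
            (2 * |i.cf| * (Fintype.card (Fin N × Fin N) : ℝ) * (1 * (1 * Real.exp (|η| * R') * 1 * (1 * Real.exp (|η| * R'))))) *
          (1 + 4 / (min ((1 / 8 : ℝ) * (((((ℓ + 1) ^ i.k : ℕ) : ℝ)) ^ 2)⁻¹) 1 - 2 * ((B + 1) * ((N * N : ℕ) * B6.c0 1 ρ ^ (d + 1))) * R₁ / Rc) *
              (1 * (Fintype.card (Fin N × Fin N) : ℝ) *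
                    (1 * ((1 * Real.exp (|η| * R')) ^ ((d + 1) * ((ℓ + 1) ^ i.k - 1)) * 1 * (1 * Real.exp (|η| * R')) ^ ((d + 1) * ((ℓ + 1) ^ i.k - 1)))) *
                  (1 * (Fintype.card (Fin N × Fin N) : ℝ) *
                    (1 * ((1 * Real.exp (|η| * R')) ^ ((d + 1) * ((ℓ + 1) ^ i.k - 1)) * 1 * (1 * Real.exp (|η| * R')) ^ ((d + 1) * ((ℓ + 1) ^ i.k - 1))))) *
                  (1 * Real.sqrt ((((ℓ : ℝ) + 1) ^ i.k) ^ (d + 1)) *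
                    (4 / (((4 * ((d : ℝ) + 1) + 1) ^ 2)⁻¹ -
                      2 * ((Real.sqrt ((((ℓ : ℝ) + 1) ^ i.k) ^ (d + 1)) * 1 * (BX + 1)) * (((N * N : ℕ) : ℝ) * B6.c0 1 (κ₁ - μ) ^ (d + 1))) * R' / R₁))) *
                  Real.exp (2 * κ * (((d : ℝ) + 1) * (((((ℓ + 1) ^ i.k : ℕ) : ℝ)) - 1))) *
                  (4 / (min ((1 / 8 : ℝ) * (((((ℓ + 1) ^ i.k : ℕ) : ℝ)) ^ 2)⁻¹) 1 - 2 * ((B + 1) * ((N * N : ℕ) * B6.c0 1 ρ ^ (d + 1))) * R₁ / Rc)) *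
                (((N * N : ℕ) : ℝ) * B6.c0 1 μ' ^ (d + 1))) *
            (((N * N : ℕ) : ℝ) * B6.c0 1 μ' ^ (d + 1))) *
          Real.exp (2 * (κ - 2 * μ') * 1) +
        1) := by
  -- L1 §5: `G′_□`'s pencil letters at the fine reading, `(R₁, κ₁, 4∕m₁′)`
  have hGsq := rawEntryLetters_toMatrix_GsqY_parSymY_prodCfg_of_reg335_fineReading i hG hC0 hC1 hreg D η hRc.le hρ hB hR₁.le hR₁R hmarg₁
    hκ₁.le hκ₁4 hκ₁m
  -- L2 (located): `C_□`'s pencil letters at the block reading, `(R′, κ, B_C)`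
  have hC := rawEntryLetters_toMatrix_ClocY_parSymY_prodCfg_of_reg335_located i hG hC0 hC1 hreg D hDD η hRc hρ hB hR₁ hR₁R hmarg₁ hκ₁ hκ₁4 hκ₁m
    hμ hμκ hBX hR' hR'R hmarg hκ hκ4 hκm
  -- `G′_□`'s letters restricted to `(R′, κ)`
  have hκκ₁ : κ ≤ κ₁ := by linarith
  have hGsq' := rawEntryLetters_mono hGsq hR'R hκκ₁ le_rfl
  -- the background's size numeral `K₀ = 1`
  have hU1 := norm_unit_le_one_of_mem i hG hreg.1
  -- L3 §4: `R_□`'s pencil letters on the site sector, `(R′, κ − 2μ′, B_R)` (operator arguments by unification — dag-n10-w3 g5's kernel note)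
  have hR := rawEntryLetters_toMatrix_RlocY_parSymY_prodCfg i (Matrix.stdBasis ℂ (Fin N) (Fin N)) _ _ _ _
    hU1.1 hU1.2 le_rfl hR'
    (fun _ _ h => tdist_chart_blkCornerY_le_of_blkOf_eq i (qpK_ne_zero_imp i h))
    (fun _ _ h => tdist_chart_blkCornerY_le_of_blkOf_eq i (qpsK_ne_zero_imp i h))
    norm_stdBasis_repr_le zero_le_one norm_stdBasis_le_one zero_le_one
    zero_le_one (sum_abs_qpsK_le_one i) zero_le_one (sum_abs_qpK_col_le_one i)
    (fineReadingY i i.hN) (blkReadingY i i.hN) (hℓQ_blkReadingY i i.hN) (hℓQs_blkReadingY i i.hN)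
    (hfib_fineReadingY_matrixUnits i i.hN) hκ hGsq' hC hμ' h2μ'.le
  -- the local part `Δ(U) + Q*(U)aQ(U)` along the pencil at the bond reading, `(R′, κ − 2μ′, B_L)`
  have hρ3 : 0 ≤ κ - 2 * μ' := by linarith
  have hLoc := rawEntryLetters_toMatrix_localDeltaA_prodCfg_located i hG hreg.1 i.hN η hR' hρ3
  -- L4 §2: `Δ_{a,□}` along the pencil; §3: the Dirichlet compression by the bond cut
  have hΔ := rawEntryLetters_toMatrix_deltaALocY_prodCfg i (Matrix.stdBasis ℂ (Fin N) (Fin N)) _ _ _ _ _ _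
    hU1.1 hU1.2 le_rfl hR'
    (by positivity) (sum_abs_gradK_le i) (by positivity) (sum_abs_divK_le i)
    norm_stdBasis_repr_le zero_le_one norm_stdBasis_le_one zero_le_one
    (fineReadingY i i.hN) (bondReadingY i i.hN) (hℓG_bondReadingY i i.hN) (hℓD_bondReadingY i i.hN) hρ3 hR hLoc
  exact rawEntryLetters_toMatrix_padDeltaALocY_prodCfg i _ _ _ _ _ _ hΔ hρ3 hχ

/-! ## §2. ★★★ The `U₀ = 1` instance — row 17's `hA` -/

/-- ★★★ **ROW 17's LETTERS: `A′ ↦ padDeltaALocY (e^{iηA′}·1)` IN N10 COORDINATES AROUND THE FLAT BACKGROUND `U₀ = 1`** — §1 at `U₀ = 1`, whose class hypothesis is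
`B9BackgroundsKLevelV1.reg335_one` at `c = (16·M·(d+1))⁻¹`, `α₀ = 1` (`c·M·α₀·(d+1) = 1∕16`; `0 < M` by `eta_pos_L_one_le_M_pos`), `1 ∈ G` by `one_mem`.  DISPLAYED: `G ≤ U(N)`,
`hDD`, `hχ`, `η`, `Rc`, `ρ`, and the numeric windows of §1 — nothing operator-side.  This is the letters input `hA` of dag-n10-w3's station L5
`B13DirichletLocalCoerciveBall.posDefTr_padDeltaALocY_parSymY_prodCfg_one_of_sup_lt` ∕ of dag-n06-j's `…N06Row17LocalCentreEveryCubeOfKIdx.posDefTr_padDeltaALocY_of_L5_of_regYP335_of_KIdx`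
([Balaban1985BackgroundPropagators] p. 416: «G_□(e^{iηA}) = G_□(1)(I − V(A)G_□(1))⁻¹ … a small perturbation»).
[cite: Balaban1985BackgroundPropagators, Thm 3.11 proof p.416, Sect. C pp.408–409, (3.87) p.409, (3.105) p.414, Thm 3.10 (3.107)–(3.108) p.416, (3.25)–(3.26) pp.394–395;
Balaban1988RG2Cluster, (2.5)–(2.7) pp.12–13, p.15; Balaban1984PropagatorsII, Lemma 2.1 (2.61) p.234] -/
theorem rawEntryLetters_toMatrix_padDeltaALocY_parSymY_prodCfg_one_located
    (hG : G ≤ B7Prop2Explicit.unitaryUnits (Matrix (Fin N) (Fin N) ℂ)) (D : Finset (SiteY i)) {Dblk : Finset (BlkY i)}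
    (hDD : ∀ z : SiteY i, blkOf i.D.toDomains z ∈ Dblk → z ∈ D)
    {χ : FBondY i → ℝ} (hχ : ∀ bb, χ bb = 0 ∨ χ bb = 1)
    (η : ℝ) {Rc : ℝ} (hRc : 0 < Rc) {ρ : ℝ} (hρ : 0 < ρ)
    {B : ℝ} (hB : B = (1 * (((d : ℝ) + 1) *
          (1 * Real.exp (|η| * Rc) * (1 * Real.exp (|η| * Rc) * 1 * (1 * Real.exp (|η| * Rc)) + 1) * (1 * Real.exp (|η| * Rc)) +
            (1 * Real.exp (|η| * Rc) * 1 * (1 * Real.exp (|η| * Rc)) + 1)) +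
          1 * ((1 * Real.exp (|η| * Rc)) ^ (2 * (d + 1) * ((ℓ + 1) ^ i.k - 1)) * 1 * (1 * Real.exp (|η| * Rc)) ^ (2 * (d + 1) * ((ℓ + 1) ^ i.k - 1)))) *
          Real.exp (ρ * (((d : ℝ) + 1) * ((((ℓ + 1) ^ i.k : ℕ) : ℝ))))))
    {R₁ : ℝ} (hR₁ : 0 < R₁) (hR₁R : R₁ ≤ Rc)
    (hmarg₁ : 0 < min ((1 / 8 : ℝ) * (((((ℓ + 1) ^ i.k : ℕ) : ℝ)) ^ 2)⁻¹) 1 - 2 * ((B + 1) * ((N * N : ℕ) * B6.c0 1 ρ ^ (d + 1))) * R₁ / Rc)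
    {κ₁ : ℝ} (hκ₁ : 0 < κ₁) (hκ₁4 : κ₁ ≤ ρ / 4)
    (hκ₁m : 8 * (B + 1) * κ₁ * ((N * N : ℕ) * B6.c0 1 (ρ / 2) ^ (d + 1)) ≤
      (min ((1 / 8 : ℝ) * (((((ℓ + 1) ^ i.k : ℕ) : ℝ)) ^ 2)⁻¹) 1 - 2 * ((B + 1) * ((N * N : ℕ) * B6.c0 1 ρ ^ (d + 1))) * R₁ / Rc) * ρ)
    {μ : ℝ} (hμ : 0 < μ) (hμκ : μ < κ₁)
    {BX : ℝ} (hBX : BX = 1 * (Fintype.card (Fin N × Fin N) : ℝ) *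
          (1 * ((1 * Real.exp (|η| * Rc)) ^ ((d + 1) * ((ℓ + 1) ^ i.k - 1)) * 1 * (1 * Real.exp (|η| * Rc)) ^ ((d + 1) * ((ℓ + 1) ^ i.k - 1)))) *
        ((((ℓ : ℝ) + 1) ^ i.k) ^ (d + 1) * (Fintype.card (Fin N × Fin N) : ℝ) *
          (1 * ((1 * Real.exp (|η| * Rc)) ^ ((d + 1) * ((ℓ + 1) ^ i.k - 1)) * 1 * (1 * Real.exp (|η| * Rc)) ^ ((d + 1) * ((ℓ + 1) ^ i.k - 1))))) *
        (4 / (min ((1 / 8 : ℝ) * (((((ℓ + 1) ^ i.k : ℕ) : ℝ)) ^ 2)⁻¹) 1 - 2 * ((B + 1) * ((N * N : ℕ) * B6.c0 1 ρ ^ (d + 1))) * R₁ / Rc) *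
          (4 / (min ((1 / 8 : ℝ) * (((((ℓ + 1) ^ i.k : ℕ) : ℝ)) ^ 2)⁻¹) 1 - 2 * ((B + 1) * ((N * N : ℕ) * B6.c0 1 ρ ^ (d + 1))) * R₁ / Rc)) *
          (((N * N : ℕ) : ℝ) * B6.c0 1 μ ^ (d + 1))) *
        Real.exp (2 * (κ₁ - μ) * (((d : ℝ) + 1) * (((((ℓ + 1) ^ i.k : ℕ) : ℝ)) - 1))))
    {R' : ℝ} (hR' : 0 ≤ R') (hR'R : R' ≤ R₁)
    (hmarg : 0 < ((4 * ((d : ℝ) + 1) + 1) ^ 2)⁻¹ -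
      2 * ((Real.sqrt ((((ℓ : ℝ) + 1) ^ i.k) ^ (d + 1)) * 1 * (BX + 1)) * (((N * N : ℕ) : ℝ) * B6.c0 1 (κ₁ - μ) ^ (d + 1))) * R' / R₁)
    {κ : ℝ} (hκ : 0 ≤ κ) (hκ4 : κ ≤ (κ₁ - μ) / 4)
    (hκm : 8 * (Real.sqrt ((((ℓ : ℝ) + 1) ^ i.k) ^ (d + 1)) * 1 * (BX + 1)) * κ * (((N * N : ℕ) : ℝ) * B6.c0 1 ((κ₁ - μ) / 2) ^ (d + 1)) ≤
      (((4 * ((d : ℝ) + 1) + 1) ^ 2)⁻¹ -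
        2 * ((Real.sqrt ((((ℓ : ℝ) + 1) ^ i.k) ^ (d + 1)) * 1 * (BX + 1)) * (((N * N : ℕ) : ℝ) * B6.c0 1 (κ₁ - μ) ^ (d + 1))) * R' / R₁) * (κ₁ - μ))
    {μ' : ℝ} (hμ' : 0 < μ') (h2μ' : 2 * μ' < κ) :
    RawEntryLetters (fun a : Fin (d + 1) → Site (PV d ℓ i.m i.K hd hL) 0 → Matrix (Fin N) (Fin N) ℂ =>
        LinearMap.toMatrix
          ((Pi.basis fun _ : FBondY i => Matrix.stdBasis ℂ (Fin N) (Fin N)).reindex (Equiv.sigmaEquivProd (FBondY i) (Fin N × Fin N)))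
          ((Pi.basis fun _ : FBondY i => Matrix.stdBasis ℂ (Fin N) (Fin N)).reindex (Equiv.sigmaEquivProd (FBondY i) (Fin N × Fin N)))
          (padDeltaALocY i (parSymY i) (parBY i) D (cutMulY (blkIndY i Dblk)) (cutMulY χ)
            (prodCfg (1 : CfgY (Matrix (Fin N) (Fin N) ℂ) i) η a)))
      (fun p : FBondY i × (Fin N × Fin N) => bondReadingY i i.hN p.1) R' (κ - 2 * μ')
      (1 * (((4 * ((d : ℝ) + 1) * |i.cf|) * (1 * Real.exp (|η| * R') *
              ((1 * Real.exp (|η| * R')) ^ 4 * ((4 * |i.cf|) * (1 * Real.exp (|η| * R') * 1 * (1 * Real.exp (|η| * R'))))) *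
              (1 * Real.exp (|η| * R'))) +
            1 / 2 * ((4 * ((d : ℝ) + 1)) * (1 * Real.exp (|η| * R') *
              (2 * (i.cf ^ 2 * (1 * Real.exp (|η| * R')) ^ 4) * (8 * (1 * Real.exp (|η| * R') * 1 * (1 * Real.exp (|η| * R'))))) *
              (1 * Real.exp (|η| * R'))))) +
          2 * ((1 * Real.exp (|η| * R')) ^ ((d + 2) * ((ℓ + 1) ^ i.k - 1)) *
            ((|b₁| * i.cf ^ 2 * ((((ℓ + 1 : ℕ) : ℝ)) ^ i.k) ^ (d + 1)) *
              (1 * ((1 * Real.exp (|η| * R')) ^ ((d + 2) * ((ℓ + 1) ^ i.k - 1)) * 1 * (1 * Real.exp (|η| * R')) ^ ((d + 2) * ((ℓ + 1) ^ i.k - 1))))) *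
            (1 * Real.exp (|η| * R')) ^ ((d + 2) * ((ℓ + 1) ^ i.k - 1)))) *
          Real.exp ((κ - 2 * μ') * (2 * (((d : ℝ) + 2) * ((((ℓ + 1) ^ i.k : ℕ) : ℝ) - 1)))) +
        2 * |i.cf| * (Fintype.card (Fin N × Fin N) : ℝ) * (1 * (1 * Real.exp (|η| * R') * 1 * (1 * Real.exp (|η| * R')))) *
            (2 * |i.cf| * (Fintype.card (Fin N × Fin N) : ℝ) * (1 * (1 * Real.exp (|η| * R') * 1 * (1 * Real.exp (|η| * R'))))) *
          (1 + 4 / (min ((1 / 8 : ℝ) * (((((ℓ + 1) ^ i.k : ℕ) : ℝ)) ^ 2)⁻¹) 1 - 2 * ((B + 1) * ((N * N : ℕ) * B6.c0 1 ρ ^ (d + 1))) * R₁ / Rc) *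
              (1 * (Fintype.card (Fin N × Fin N) : ℝ) *
                    (1 * ((1 * Real.exp (|η| * R')) ^ ((d + 1) * ((ℓ + 1) ^ i.k - 1)) * 1 * (1 * Real.exp (|η| * R')) ^ ((d + 1) * ((ℓ + 1) ^ i.k - 1)))) *
                  (1 * (Fintype.card (Fin N × Fin N) : ℝ) *
                    (1 * ((1 * Real.exp (|η| * R')) ^ ((d + 1) * ((ℓ + 1) ^ i.k - 1)) * 1 * (1 * Real.exp (|η| * R')) ^ ((d + 1) * ((ℓ + 1) ^ i.k - 1))))) *
                  (1 * Real.sqrt ((((ℓ : ℝ) + 1) ^ i.k) ^ (d + 1)) *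
                    (4 / (((4 * ((d : ℝ) + 1) + 1) ^ 2)⁻¹ -
                      2 * ((Real.sqrt ((((ℓ : ℝ) + 1) ^ i.k) ^ (d + 1)) * 1 * (BX + 1)) * (((N * N : ℕ) : ℝ) * B6.c0 1 (κ₁ - μ) ^ (d + 1))) * R' / R₁))) *
                  Real.exp (2 * κ * (((d : ℝ) + 1) * (((((ℓ + 1) ^ i.k : ℕ) : ℝ)) - 1))) *
                  (4 / (min ((1 / 8 : ℝ) * (((((ℓ + 1) ^ i.k : ℕ) : ℝ)) ^ 2)⁻¹) 1 - 2 * ((B + 1) * ((N * N : ℕ) * B6.c0 1 ρ ^ (d + 1))) * R₁ / Rc)) *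
                (((N * N : ℕ) : ℝ) * B6.c0 1 μ' ^ (d + 1))) *
            (((N * N : ℕ) : ℝ) * B6.c0 1 μ' ^ (d + 1))) *
          Real.exp (2 * (κ - 2 * μ') * 1) +
        1) := by
  -- the centre: `1 ∈ (3.35)` at `c = (16·M·(d+1))⁻¹`, `α₀ = 1`
  have hM : 0 < (kGeo i).M := (eta_pos_L_one_le_M_pos i).2.2
  have hd1 : (0 : ℝ) < (d : ℝ) + 1 := by positivity
  have hc : (0 : ℝ) < (16 * (kGeo i).M * ((d : ℝ) + 1))⁻¹ := by positivity
  have hreg : (bg9K (Matrix (Fin N) (Fin N) ℂ) G i).Reg335 (16 * (kGeo i).M * ((d : ℝ) + 1))⁻¹ 1 (1 : CfgY (Matrix (Fin N) (Fin N) ℂ) i) :=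
    reg335_one i hc one_pos
  have hC0 : 0 ≤ (16 * (kGeo i).M * ((d : ℝ) + 1))⁻¹ * (kGeo i).M * 1 := by positivity
  have hpos : 0 < 16 * (kGeo i).M * ((d : ℝ) + 1) := by positivity
  have hC1 : (16 * (kGeo i).M * ((d : ℝ) + 1))⁻¹ * (kGeo i).M * 1 * ((d : ℝ) + 1) ≤ 1 / 16 := by
    rw [mul_one, inv_mul_eq_div, div_mul_eq_mul_div, div_le_iff₀ hpos]
    linarith
  exact rawEntryLetters_toMatrix_padDeltaALocY_parSymY_prodCfg_of_reg335_located i hG hC0 hC1 hreg D hDD hχ η hRc hρ hB hR₁ hR₁R hmarg₁ hκ₁ hκ₁4 hκ₁m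
    hμ hμκ hBX hR' hR'R hmarg hκ hκ4 hκm hμ' h2μ'

end Literature.MathematicalPhysics.QuantumFieldTheory.Balaban1983to89.B13DirichletLocalRoadPadLettersLocated

end
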